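import Summits.Ventures.LatticeQCDFlow.Scaling.FlowHubProposalLaw
import Summits.Ventures.LatticeQCDFlow.Scaling.OneSidedHubCorollaries

/-!
HONEST FRAMING: exact (Metropolis-corrected) sampling algorithms for lattice gauge theory; figures
of merit are autocorrelation/cost numbers at stated couplings and volumes; no continuum-physics
claim.

# HubListCurrencies — THE PROPOSAL-LAW FLOORS IN THE OTHER CURRENCIES: A HUB SCHEME ON ANY EDGE LIST CONTAINING THE
# HUB IS IRREDUCIBLE AS SOON AS THE HOT UPDATE IS (WITH OR WITHOUT LEVEL MAPS); WITH `C = p·min{t·c/(6m),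
# γ₀(1−t)w_0/(14K)}`: `τ_int(g) ≤ 1/C − ½` FOR EVERY OBSERVABLE, EQUILIBRIUM TUNNELLING WITHIN `(1−μ_k(A))/(C·μ_k(A))`,
# LAZY MIXING WITHIN `⌈(2/C)(½log(1/π_min) + log(1/(2ε)))⌉` (lean-2 GEN-23, ours)

Venture-side (OURS).  Cell `lqcd-flow` (pub-lqcd), unit `pub-lqcd-lean-2-g23`, 2026-08-26.  Chapter K, file 6: the
corollaries of `Scaling/HubProposalLaw` (K2) and `Scaling/FlowHubProposalLaw` (K4) in the currencies of
`Scaling/OneSidedHubCorollaries` (J9) — integrated autocorrelation times (`Scaling/FlowSamplerTauInt`), equilibrium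
tunnelling times (`Scaling/FlowSamplerTunnelingTime`) and lazy mixing times
(`Scaling/ReplicaExchangeModeMixingTime`).  Schemes: `P = t·ptGraphSwap μ e 1 + (1−t)·prodKernel w M` on an edge list
`e` of `m` entries with distinct endpoints listing every hub edge `(0, k+1)` at least `c ≥ 1` times, and the
map-assisted hub list `P^φ` of K4 (`e_r = (0, κ_r+1)` with the level map `φ_{κ_r}`).

## What is proved

* §1 **`hubGraph_isIrreducible_of_hot`** — ANY edge list containing every hub edge, identity maps, `w_0 > 0`,
  `0 < t < 1`: the scheme is irreducible as soon as the hot update `M_0` is (cold updates arbitrary);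
  **`flowHubList_isIrreducible_of_hot`** — the same for the map-assisted hub list (by K4's conjugacy).
* §2 **`multiHub_tauInt_le`**, **`flowHubList_tauInt_le`** — `τ_int(g) ≤ 1/C − ½` for every non-constant observable,
  `C = p·min{t·c/(6m), γ₀(1−t)w_0/(14K)}` (one-sided, resp. transported, domination).
* §3 **`multiHub_tunnelingTime_le`**, **`flowHubList_tunnelingTime_le`** — from equilibrium, replica `k` enters `A`
  within `(1 − μ_k(A))/(C·μ_k(A))` expected steps.
* §4 **`multiHub_mixingTime_le`** — `t_mix(lazy P; ε) ≤ ⌈(2/C)(½log(1/m₀^{K+1}) + log(1/(2ε)))⌉` for `μ_k ≥ m₀`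
  pointwise, `0 < ε ≤ ½`.

Reading (no numerics implied): every consequence the tree drew from the star floors holds for an arbitrary proposal law
over the hub edges (and arbitrary cold–cold entries) with the rarest hub edge's frequency `c/m` in place of `1/K`.
NOT CLAIMED: ceilings in these currencies; continuous spaces; anything measured.  Literature grade (cell rule): OWN
COMPOSITION; nothing cited as a fact; no new bib keys.
-/

noncomputable section

open Finset Function
open Literature.Probability.MarkovChains

namespace Summit.Ventures.LatticeQCDFlow.Scaling

variable {S : Type*} [Fintype S] [DecidableEq S] {K m : ℕ} {μ : Fin (K + 1) → S → ℝ}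
  {M : Fin (K + 1) → S → S → ℝ} {w : Fin (K + 1) → ℝ} {t : ℝ} {e : Fin m → Fin (K + 1) × Fin (K + 1)}

/-! ## §1 Irreducibility from the hot update -/

/-- **A hub scheme on ANY edge list containing the hub is irreducible as soon as the HOT update is** (identity maps,
distinct endpoints, `0 < t < 1`, `w ≥ 0`, `Σw = 1`, `w_0 > 0`, positive laws; cold updates arbitrary). [ours] -/
theorem hubGraph_isIrreducible_of_hot (he : ∀ r, (e r).1 ≠ (e r).2)
    (hhub : ∀ k : Fin K, ∃ j, e j = ((0 : Fin (K + 1)), k.succ)) (hμ : ∀ k x, 0 < μ k x)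
    (hM : ∀ k, IsRowStochastic (M k)) (hM0 : IsIrreducible (M 0)) (hw0 : ∀ k, 0 ≤ w k) (hw1 : ∑ k, w k = 1)
    (hwhot : 0 < w 0) (ht0 : 0 < t) (ht1 : t < 1) :
    IsIrreducible (fun x y : Fin (K + 1) → S =>
      t * ptGraphSwap μ e (fun _ : Fin m => Equiv.refl S) x y + (1 - t) * prodKernel w M x y) := by
  have hQ := ptGraphSwap_isRowStochastic (e := e) (φ := fun _ : Fin m => Equiv.refl S) hμ
  have hP0 := (weightedScheme_isRowStochastic hQ hM hw0 hw1 ht0.le ht1.le).1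
  refine isIrreducible_of_forall_closed hP0 fun T hT hcl => ?_
  -- (A) a move of the hot replica
  have moveA : ∀ (x : Fin (K + 1) → S) (v : S), x ∈ T → 0 < M 0 (x 0) v → update x 0 v ∈ T := by
    intro x v hx hv
    by_cases hvx : v = x 0
    · rw [hvx, update_eq_self]; exact hx
    refine hcl x hx (update x 0 v) ?_
    have h := whub_hot_flow_ge (M := M) (w := w) (t := t) hQ.1 hμ ht0.le x hvx
    have hpos : 0 < (1 - t) * w 0 * (tensorFun μ x * M 0 (x 0) v) :=
      mul_pos (mul_pos (by linarith) hwhot) (mul_pos (tensorFun_pos hμ x) hv)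
    exact (mul_pos_iff_of_pos_left (tensorFun_pos hμ x)).mp (lt_of_lt_of_le hpos h)
  -- (B) the whole hot coordinate
  have moveB : ∀ x : Fin (K + 1) → S, x ∈ T → ∀ v, update x 0 v ∈ T := by
    intro x hx v
    set V : Finset S := univ.filter fun u => update x 0 u ∈ T with hV
    have hxk : x 0 ∈ V := by rw [hV, Finset.mem_filter, update_eq_self]; exact ⟨mem_univ _, hx⟩
    have hclV : ∀ u ∈ V, ∀ u', 0 < M 0 u u' → u' ∈ V := by
      intro u hu u' huu'
      rw [hV, Finset.mem_filter] at hu ⊢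
      refine ⟨mem_univ _, ?_⟩
      have := moveA (update x 0 u) u' hu.2 (by rwa [update_self])
      rwa [update_idem] at this
    have hVu := hM0.eq_univ_of_closed (hM 0).1 ⟨x 0, hxk⟩ hclV
    have hv : v ∈ V := by rw [hVu]; exact mem_univ _
    rw [hV, Finset.mem_filter] at hv
    exact hv.2
  -- (C) hub swaps have positive probability
  have swapPos : ∀ (x : Fin (K + 1) → S) (k : Fin K), x ∈ T → x ∘ Equiv.swap (0 : Fin (K + 1)) k.succ ∈ T := by
    intro x k hx
    by_cases hxk : x ∘ Equiv.swap (0 : Fin (K + 1)) k.succ = x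
    · rw [hxk]; exact hx
    refine hcl x hx _ ?_
    obtain ⟨j, hj⟩ := hhub k
    have h := whub_swap_flow_ge (M := M) (w := w) e he hμ hM hw0 hw1 ht0.le ht1.le x hj hxk
    have hm0 : 0 < m := by have := j.2; omega
    have hpos : 0 < t / m * min (tensorFun μ x) (tensorFun μ (x ∘ Equiv.swap (0 : Fin (K + 1)) k.succ)) :=
      mul_pos (div_pos ht0 (by exact_mod_cast hm0)) (lt_min (tensorFun_pos hμ _) (tensorFun_pos hμ _))
    exact (mul_pos_iff_of_pos_left (tensorFun_pos hμ x)).mp (lt_of_lt_of_le hpos h)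
  -- (D) every coordinate, by the star conveyor identity
  have moveD : ∀ (k : Fin (K + 1)) (x : Fin (K + 1) → S), x ∈ T → ∀ v, update x k v ∈ T := by
    intro k
    induction k using Fin.cases with
    | zero => exact moveB
    | succ l =>
      intro x hx v
      rw [update_succ_eq_conj_swap x l v]
      exact swapPos _ l (moveB _ (swapPos x l hx) v)
  -- (E) everything
  obtain ⟨x₀, hx₀⟩ := hT
  have key : ∀ (y : Fin (K + 1) → S) (s : Finset (Fin (K + 1))), s.piecewise y x₀ ∈ T := by
    intro y s
    induction s using Finset.induction_on with
    | empty => rwa [Finset.piecewise_empty]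
    | insert k s hk ih =>
      rw [Finset.piecewise_insert]
      exact moveD k _ ih _
  refine Finset.eq_univ_of_forall fun y => ?_
  have := key y univ
  rwa [Finset.piecewise_univ] at this

/-- **The map-assisted hub list is irreducible as soon as the hot update is** (every hub edge listed at least once:
`κ` surjective; any level maps; `w_0 > 0`; cold updates arbitrary). [ours] -/
theorem flowHubList_isIrreducible_of_hot (κ : Fin m → Fin K) (φ : Fin K → Equiv.Perm S)
    (hκ : Function.Surjective κ) (hμ : ∀ k x, 0 < μ k x) (hM : ∀ k, IsRowStochastic (M k))
    (hM0 : IsIrreducible (M 0)) (hw0 : ∀ k, 0 ≤ w k) (hw1 : ∑ k, w k = 1) (hwhot : 0 < w 0) (ht0 : 0 < t)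
    (ht1 : t < 1) :
    IsIrreducible (fun x y : Fin (K + 1) → S =>
      t * ptGraphSwap μ (fun r : Fin m => ((0 : Fin (K + 1)), (κ r).succ)) (fun r => φ (κ r)) x y
        + (1 - t) * prodKernel w M x y) := by
  set L : Fin (K + 1) → Equiv.Perm S := Fin.cons (Equiv.refl S) (fun k => (φ k).symm) with hL
  have hL0u : ∀ u, (L 0).symm u = u := fun u => by rw [hL, starLevel_zero]; rfl
  have hM0' : (fun u v => M 0 ((L 0).symm u) ((L 0).symm v)) = M 0 := funext fun u => funext fun v => by rw [hL0u, hL0u]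
  have hirr : IsIrreducible (fun x y : Fin (K + 1) → S =>
      t * ptGraphSwap (fun i u => μ i ((L i).symm u)) (fun r : Fin m => ((0 : Fin (K + 1)), (κ r).succ))
          (fun _ : Fin m => Equiv.refl S) x y
        + (1 - t) * prodKernel w (fun i u v => M i ((L i).symm u) ((L i).symm v)) x y) := by
    refine hubGraph_isIrreducible_of_hot (fun r => (Fin.succ_ne_zero (κ r)).symm)
      (fun k => by obtain ⟨r, hr⟩ := hκ k; exact ⟨r, by rw [hr]⟩) (fun k u => hμ k _)
      (fun k => ⟨fun u v => (hM k).1 _ _,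
        fun u => by simpa using (Equiv.sum_comp (L k).symm (fun v => M k ((L k).symm u) v)).trans ((hM k).2 _)⟩)
      ?_ hw0 hw1 hwhot ht0 ht1
    show IsIrreducible (fun u v => M 0 ((L 0).symm u) ((L 0).symm v))
    rw [hM0']; exact hM0
  have h := isIrreducible_relabel (Equiv.piCongrRight L) hirr
  have eq : (fun a b : Fin (K + 1) → S =>
      t * ptGraphSwap (fun i u => μ i ((L i).symm u)) (fun r : Fin m => ((0 : Fin (K + 1)), (κ r).succ))
          (fun _ : Fin m => Equiv.refl S) (Equiv.piCongrRight L a) (Equiv.piCongrRight L b)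
        + (1 - t) * prodKernel w (fun i u v => M i ((L i).symm u) ((L i).symm v))
          (Equiv.piCongrRight L a) (Equiv.piCongrRight L b))
      = fun x y : Fin (K + 1) → S =>
          t * ptGraphSwap μ (fun r : Fin m => ((0 : Fin (K + 1)), (κ r).succ)) (fun r => φ (κ r)) x y
            + (1 - t) * prodKernel w M x y := by
    funext a b
    rw [starRelabel_apply, starRelabel_apply]
    exact (flowHubList_apply_eq_conj κ φ hμ t w a b).symm
  rw [eq] at h
  exact h

/-! ## §2 `τ_int` of every observable -/

/-- **HUB SCHEME ON ANY LIST, EVERY OBSERVABLE:** one-sided domination `p·μ_{k+1} ≤ μ_0`, hot update irreducible with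
Poincaré constant `γ₀`, every hub edge listed `≥ c ≥ 1` times, `w_0 > 0`:
`τ_int(g) ≤ 1/(p·min{t·c/(6m), γ₀(1−t)w_0/(14K)}) − ½` for every non-constant `g`. [ours] -/
theorem multiHub_tauInt_le [Nontrivial S] (hK : 1 ≤ K) (hm : 1 ≤ m) (he : ∀ r, (e r).1 ≠ (e r).2) {c : ℕ}
    (hc : ∀ k : Fin K, c ≤ (univ.filter (fun r : Fin m => e r = ((0 : Fin (K + 1)), k.succ))).card) (hc1 : 1 ≤ c)
    (hμ : ∀ k x, 0 < μ k x) (hμ1 : ∀ k, ∑ u, μ k u = 1) (hM : ∀ k, IsRowStochastic (M k))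
    (hMrev : ∀ k, DetailedBalance (μ k) (M k)) (hM0 : IsIrreducible (M 0)) (hw0 : ∀ k, 0 ≤ w k)
    (hw1 : ∑ k, w k = 1) (hwhot : 0 < w 0) (ht0 : 0 < t) (ht1 : t < 1) {p γ₀ : ℝ} (hp : 0 < p) (hp1 : p ≤ 1)
    (hγ₀ : 0 < γ₀) (hdom : ∀ (k : Fin K) (u : S), p * μ k.succ u ≤ μ 0 u)
    (hgap0 : ∀ h : S → ℝ, γ₀ * lawVariance (μ 0) h ≤ dirichletForm (μ 0) (M 0) h)
    {g : (Fin (K + 1) → S) → ℝ} (hg : 0 < lawVariance (tensorFun μ) g) :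
    asympVar g (tensorFun μ) (fun x y : Fin (K + 1) → S =>
        t * ptGraphSwap μ e (fun _ : Fin m => Equiv.refl S) x y + (1 - t) * prodKernel w M x y)
      / (2 * lawVariance (tensorFun μ) g) ≤ 1 / (p * min (t * c / (6 * m)) (γ₀ * (1 - t) * w 0 / (14 * K))) - 1 / 2 := by
  have hKpos : (0 : ℝ) < K := Nat.cast_pos.mpr (by omega)
  have hmpos : (0 : ℝ) < m := Nat.cast_pos.mpr (by omega)
  have hcpos : (0 : ℝ) < c := Nat.cast_pos.mpr (by omega)
  have hc0 : 0 < p * min (t * c / (6 * m)) (γ₀ * (1 - t) * w 0 / (14 * K)) :=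
    mul_pos hp (lt_min (by positivity) (div_pos (mul_pos (mul_pos hγ₀ (by linarith)) hwhot) (by positivity)))
  have hhub : ∀ k : Fin K, ∃ j, e j = ((0 : Fin (K + 1)), k.succ) := fun k => by
    have hne : (univ.filter (fun r : Fin m => e r = ((0 : Fin (K + 1)), k.succ))).Nonempty :=
      Finset.card_pos.mp (lt_of_lt_of_le (by omega) (hc k))
    obtain ⟨j, hj⟩ := hne
    exact ⟨j, (Finset.mem_filter.mp hj).2⟩
  exact tauInt_le_of_gapFloor (tensorFun_pos hμ) (sum_tensorFun_eq_one μ hμ1)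
    (weightedScheme_isRowStochastic (ptGraphSwap_isRowStochastic hμ) hM hw0 hw1 ht0.le ht1.le)
    (weightedScheme_detailedBalance (ptGraphSwap_detailedBalance hμ) hMrev t)
    (hubGraph_isIrreducible_of_hot he hhub hμ hM hM0 hw0 hw1 hwhot ht0 ht1) hc0
    (multiHub_spectralGap_ge hK hm he hc hc1 hμ hμ1 hM hMrev hw0 hw1 hwhot ht0 ht1 hp hp1 hγ₀ hdom hgap0) hg

/-- **MAP-ASSISTED HUB LIST, EVERY OBSERVABLE:** transported domination `p·μ_{k+1}(φ_k u) ≤ μ_0(u)`, hot update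
irreducible with Poincaré constant `γ₀`, every hub edge listed `≥ c ≥ 1` times, `w_0 > 0`:
`τ_int(g) ≤ 1/(p·min{t·c/(6m), γ₀(1−t)w_0/(14K)}) − ½`. [ours] -/
theorem flowHubList_tauInt_le [Nontrivial S] (κ : Fin m → Fin K) (φ : Fin K → Equiv.Perm S) (hK : 1 ≤ K)
    (hm : 1 ≤ m) {c : ℕ} (hc : ∀ k : Fin K, c ≤ (univ.filter (fun r : Fin m => κ r = k)).card) (hc1 : 1 ≤ c)
    (hμ : ∀ k x, 0 < μ k x) (hμ1 : ∀ k, ∑ u, μ k u = 1) (hM : ∀ k, IsRowStochastic (M k))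
    (hMrev : ∀ k, DetailedBalance (μ k) (M k)) (hM0 : IsIrreducible (M 0)) (hw0 : ∀ k, 0 ≤ w k)
    (hw1 : ∑ k, w k = 1) (hwhot : 0 < w 0) (ht0 : 0 < t) (ht1 : t < 1) {p γ₀ : ℝ} (hp : 0 < p) (hp1 : p ≤ 1)
    (hγ₀ : 0 < γ₀) (hdom : ∀ (k : Fin K) (u : S), p * μ k.succ (φ k u) ≤ μ 0 u)
    (hgap0 : ∀ h : S → ℝ, γ₀ * lawVariance (μ 0) h ≤ dirichletForm (μ 0) (M 0) h)
    {g : (Fin (K + 1) → S) → ℝ} (hg : 0 < lawVariance (tensorFun μ) g) :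
    asympVar g (tensorFun μ) (fun x y : Fin (K + 1) → S =>
        t * ptGraphSwap μ (fun r : Fin m => ((0 : Fin (K + 1)), (κ r).succ)) (fun r => φ (κ r)) x y
          + (1 - t) * prodKernel w M x y)
      / (2 * lawVariance (tensorFun μ) g) ≤ 1 / (p * min (t * c / (6 * m)) (γ₀ * (1 - t) * w 0 / (14 * K))) - 1 / 2 := by
  have hKpos : (0 : ℝ) < K := Nat.cast_pos.mpr (by omega)
  have hmpos : (0 : ℝ) < m := Nat.cast_pos.mpr (by omega)
  have hcpos : (0 : ℝ) < c := Nat.cast_pos.mpr (by omega)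
  have hc0 : 0 < p * min (t * c / (6 * m)) (γ₀ * (1 - t) * w 0 / (14 * K)) :=
    mul_pos hp (lt_min (by positivity) (div_pos (mul_pos (mul_pos hγ₀ (by linarith)) hwhot) (by positivity)))
  have hκ : Function.Surjective κ := fun k => by
    have hne : (univ.filter (fun r : Fin m => κ r = k)).Nonempty :=
      Finset.card_pos.mp (lt_of_lt_of_le (by omega) (hc k))
    obtain ⟨j, hj⟩ := hne
    exact ⟨j, (Finset.mem_filter.mp hj).2⟩
  exact tauInt_le_of_gapFloor (tensorFun_pos hμ) (sum_tensorFun_eq_one μ hμ1)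
    (weightedScheme_isRowStochastic (ptGraphSwap_isRowStochastic hμ) hM hw0 hw1 ht0.le ht1.le)
    (weightedScheme_detailedBalance (ptGraphSwap_detailedBalance hμ) hMrev t)
    (flowHubList_isIrreducible_of_hot κ φ hκ hμ hM hM0 hw0 hw1 hwhot ht0 ht1) hc0
    (flowHubList_spectralGap_ge κ φ hK hm hc hc1 hμ hμ1 hM hMrev hw0 hw1 hwhot ht0 ht1 hp hp1 hγ₀ hdom hgap0) hg

/-! ## §3 Equilibrium tunnelling times -/

/-- **HUB SCHEME ON ANY LIST, TUNNELLING:** from equilibrium replica `k` enters `A` (`μ_k(A) > 0`) within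
`(1 − μ_k(A))/(C·μ_k(A))` expected steps, `C = p·min{t·c/(6m), γ₀(1−t)w_0/(14K)}`. [ours] -/
theorem multiHub_tunnelingTime_le [Nontrivial S] (hK : 1 ≤ K) (hm : 1 ≤ m) (he : ∀ r, (e r).1 ≠ (e r).2) {c : ℕ}
    (hc : ∀ k : Fin K, c ≤ (univ.filter (fun r : Fin m => e r = ((0 : Fin (K + 1)), k.succ))).card) (hc1 : 1 ≤ c)
    (hμ : ∀ k x, 0 < μ k x) (hμ1 : ∀ k, ∑ u, μ k u = 1) (hM : ∀ k, IsRowStochastic (M k))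
    (hMrev : ∀ k, DetailedBalance (μ k) (M k)) (hw0 : ∀ k, 0 ≤ w k) (hw1 : ∑ k, w k = 1) (hwhot : 0 < w 0)
    (ht0 : 0 < t) (ht1 : t < 1) {p γ₀ : ℝ} (hp : 0 < p) (hp1 : p ≤ 1) (hγ₀ : 0 < γ₀)
    (hdom : ∀ (k : Fin K) (u : S), p * μ k.succ u ≤ μ 0 u)
    (hgap0 : ∀ h : S → ℝ, γ₀ * lawVariance (μ 0) h ≤ dirichletForm (μ 0) (M 0) h) (k : Fin (K + 1))
    {A : Finset S} (hA : 0 < ∑ u ∈ A, μ k u) (N : ℕ) :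
    ∑ x, tensorFun μ x * meanHitWithin (fun x y : Fin (K + 1) → S =>
          t * ptGraphSwap μ e (fun _ : Fin m => Equiv.refl S) x y + (1 - t) * prodKernel w M x y)
        (↑(univ.filter (fun x : Fin (K + 1) → S => x k ∈ A)) : Set (Fin (K + 1) → S)) N x
      ≤ (1 - ∑ u ∈ A, μ k u) / (p * min (t * c / (6 * m)) (γ₀ * (1 - t) * w 0 / (14 * K)) * ∑ u ∈ A, μ k u) := by
  have hKpos : (0 : ℝ) < K := Nat.cast_pos.mpr (by omega)
  have hmpos : (0 : ℝ) < m := Nat.cast_pos.mpr (by omega)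
  have hcpos : (0 : ℝ) < c := Nat.cast_pos.mpr (by omega)
  exact tunnelingTime_le_of_gapFloor hμ hμ1
    (weightedScheme_isRowStochastic (ptGraphSwap_isRowStochastic hμ) hM hw0 hw1 ht0.le ht1.le)
    (weightedScheme_detailedBalance (ptGraphSwap_detailedBalance hμ) hMrev t)
    (mul_pos hp (lt_min (by positivity) (div_pos (mul_pos (mul_pos hγ₀ (by linarith)) hwhot) (by positivity))))
    (multiHub_spectralGap_ge hK hm he hc hc1 hμ hμ1 hM hMrev hw0 hw1 hwhot ht0 ht1 hp hp1 hγ₀ hdom hgap0) k hA N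

/-- **MAP-ASSISTED HUB LIST, TUNNELLING:** transported domination; from equilibrium replica `k` enters `A` within
`(1 − μ_k(A))/(C·μ_k(A))` expected steps. [ours] -/
theorem flowHubList_tunnelingTime_le [Nontrivial S] (κ : Fin m → Fin K) (φ : Fin K → Equiv.Perm S) (hK : 1 ≤ K)
    (hm : 1 ≤ m) {c : ℕ} (hc : ∀ k : Fin K, c ≤ (univ.filter (fun r : Fin m => κ r = k)).card) (hc1 : 1 ≤ c)
    (hμ : ∀ k x, 0 < μ k x) (hμ1 : ∀ k, ∑ u, μ k u = 1) (hM : ∀ k, IsRowStochastic (M k))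
    (hMrev : ∀ k, DetailedBalance (μ k) (M k)) (hw0 : ∀ k, 0 ≤ w k) (hw1 : ∑ k, w k = 1) (hwhot : 0 < w 0)
    (ht0 : 0 < t) (ht1 : t < 1) {p γ₀ : ℝ} (hp : 0 < p) (hp1 : p ≤ 1) (hγ₀ : 0 < γ₀)
    (hdom : ∀ (k : Fin K) (u : S), p * μ k.succ (φ k u) ≤ μ 0 u)
    (hgap0 : ∀ h : S → ℝ, γ₀ * lawVariance (μ 0) h ≤ dirichletForm (μ 0) (M 0) h) (k : Fin (K + 1))
    {A : Finset S} (hA : 0 < ∑ u ∈ A, μ k u) (N : ℕ) :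
    ∑ x, tensorFun μ x * meanHitWithin (fun x y : Fin (K + 1) → S =>
          t * ptGraphSwap μ (fun r : Fin m => ((0 : Fin (K + 1)), (κ r).succ)) (fun r => φ (κ r)) x y
            + (1 - t) * prodKernel w M x y)
        (↑(univ.filter (fun x : Fin (K + 1) → S => x k ∈ A)) : Set (Fin (K + 1) → S)) N x
      ≤ (1 - ∑ u ∈ A, μ k u) / (p * min (t * c / (6 * m)) (γ₀ * (1 - t) * w 0 / (14 * K)) * ∑ u ∈ A, μ k u) := by
  have hKpos : (0 : ℝ) < K := Nat.cast_pos.mpr (by omega)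
  have hmpos : (0 : ℝ) < m := Nat.cast_pos.mpr (by omega)
  have hcpos : (0 : ℝ) < c := Nat.cast_pos.mpr (by omega)
  exact tunnelingTime_le_of_gapFloor hμ hμ1
    (weightedScheme_isRowStochastic (ptGraphSwap_isRowStochastic hμ) hM hw0 hw1 ht0.le ht1.le)
    (weightedScheme_detailedBalance (ptGraphSwap_detailedBalance hμ) hMrev t)
    (mul_pos hp (lt_min (by positivity) (div_pos (mul_pos (mul_pos hγ₀ (by linarith)) hwhot) (by positivity))))
    (flowHubList_spectralGap_ge κ φ hK hm hc hc1 hμ hμ1 hM hMrev hw0 hw1 hwhot ht0 ht1 hp hp1 hγ₀ hdom hgap0) k hA N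

/-! ## §4 Lazy mixing times -/

/-- **HUB SCHEME ON ANY LIST, MIXING:** hot update irreducible with Poincaré constant `γ₀`, one-sided domination, every
hub edge listed `≥ c ≥ 1` times, `w_0 > 0`, `μ_k ≥ m₀ > 0` pointwise, `0 < ε ≤ ½`:
`t_mix(lazy P; ε) ≤ ⌈(2/C)(½log(1/m₀^{K+1}) + log(1/(2ε)))⌉`, `C = p·min{t·c/(6m), γ₀(1−t)w_0/(14K)}`. [ours] -/
theorem multiHub_mixingTime_le [Nontrivial S] (hK : 1 ≤ K) (hm : 1 ≤ m) (he : ∀ r, (e r).1 ≠ (e r).2) {c : ℕ}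
    (hc : ∀ k : Fin K, c ≤ (univ.filter (fun r : Fin m => e r = ((0 : Fin (K + 1)), k.succ))).card) (hc1 : 1 ≤ c)
    (hμ : ∀ k x, 0 < μ k x) (hμ1 : ∀ k, ∑ u, μ k u = 1) (hM : ∀ k, IsRowStochastic (M k))
    (hMrev : ∀ k, DetailedBalance (μ k) (M k)) (hM0 : IsIrreducible (M 0)) (hw0 : ∀ k, 0 ≤ w k)
    (hw1 : ∑ k, w k = 1) (hwhot : 0 < w 0) (ht0 : 0 < t) (ht1 : t < 1) {p γ₀ : ℝ} (hp : 0 < p) (hp1 : p ≤ 1)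
    (hγ₀ : 0 < γ₀) (hdom : ∀ (k : Fin K) (u : S), p * μ k.succ u ≤ μ 0 u)
    (hgap0 : ∀ h : S → ℝ, γ₀ * lawVariance (μ 0) h ≤ dirichletForm (μ 0) (M 0) h)
    {m₀ : ℝ} (hm₀ : 0 < m₀) (hμm : ∀ k x, m₀ ≤ μ k x) {ε : ℝ} (hε : 0 < ε) (hε2 : ε ≤ 1 / 2) :
    mixingTime (lazyVersion (fun x y : Fin (K + 1) → S =>
          t * ptGraphSwap μ e (fun _ : Fin m => Equiv.refl S) x y + (1 - t) * prodKernel w M x y)) (tensorFun μ) ε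
      ≤ ⌈2 / (p * min (t * c / (6 * m)) (γ₀ * (1 - t) * w 0 / (14 * K)))
          * (Real.log (1 / m₀ ^ (K + 1)) / 2 + Real.log (1 / (2 * ε)))⌉₊ := by
  have hKpos : (0 : ℝ) < K := Nat.cast_pos.mpr (by omega)
  have hmpos : (0 : ℝ) < m := Nat.cast_pos.mpr (by omega)
  have hcpos : (0 : ℝ) < c := Nat.cast_pos.mpr (by omega)
  have hc0 : 0 < p * min (t * c / (6 * m)) (γ₀ * (1 - t) * w 0 / (14 * K)) :=
    mul_pos hp (lt_min (by positivity) (div_pos (mul_pos (mul_pos hγ₀ (by linarith)) hwhot) (by positivity)))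
  have hhub : ∀ k : Fin K, ∃ j, e j = ((0 : Fin (K + 1)), k.succ) := fun k => by
    have hne : (univ.filter (fun r : Fin m => e r = ((0 : Fin (K + 1)), k.succ))).Nonempty :=
      Finset.card_pos.mp (lt_of_lt_of_le (by omega) (hc k))
    obtain ⟨j, hj⟩ := hne
    exact ⟨j, (Finset.mem_filter.mp hj).2⟩
  exact mixingTime_lazyVersion_le_of_gap (tensorFun_pos hμ) (sum_tensorFun_eq_one μ hμ1)
    (weightedScheme_isRowStochastic (ptGraphSwap_isRowStochastic hμ) hM hw0 hw1 ht0.le ht1.le)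
    (weightedScheme_detailedBalance (ptGraphSwap_detailedBalance hμ) hMrev t)
    (hubGraph_isIrreducible_of_hot he hhub hμ hM hM0 hw0 hw1 hwhot ht0 ht1) hc0
    (multiHub_spectralGap_ge hK hm he hc hc1 hμ hμ1 hM hMrev hw0 hw1 hwhot ht0 ht1 hp hp1 hγ₀ hdom hgap0)
    (πmin := m₀ ^ (K + 1)) (by positivity) (tensorFun_ge_pow hm₀.le hμm) hε hε2

end Summit.Ventures.LatticeQCDFlow.Scaling

end
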